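import Literature.NumberTheory.LFunctions.FreitasLiHalfPlanesSeriesProofs
import Literature.NumberTheory.LFunctions.KeiperLiAsymptoticCriteriaProofs
import HarnessLib

/-!
# Freitas 2006 — proofs, part 3: Corollary 5.3 (the sign split `F = P + N`)

LABEL (line 1): **RH-FREE** (an identity and two sign statements for series built from the values
`ζ(k)` (`k ≥ 2`), the Bombieri–Lagarias coefficients `η_k` and Euler's constant; the Li-type
criterion of the source (its Theorem 1 at `τ = 1` is RH re-indexed) is not touched).  bears_on:
LADDER-RH L-C/L-P (COLUMN 4, LI).  WHAT THIS IS NOT: nothing here bears on the truth of RH.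

Third companion of `FreitasLiHalfPlanes.lean`: the discharge `Freitas2006_cor_5_3_holds` of the named
fact `Freitas2006_cor_5_3` (P. Freitas, *A Li-type criterion for zero-free half-planes of Riemann's
zeta function*, J. London Math. Soc. (2) **73** (2006) 399–414 = arXiv:math/0507368, Corollary 5.3,
arXiv p0010:L116–138): for `x > 0` and `0 < τ < 2`, with
`P(x,τ) = Σ_{k≥1} (1/(k+1)!) x(x+1)⋯(x+k) [(1 − 2^{−k−1}) ζ(k+1) − 1] τᵏ` and
`N(x,τ) = [log(2√π) − 1 − γ/2] x + Σ_{k≥1} ((−1)ᵏ/(k+1)!) x(x+1)⋯(x+k) η_k τᵏ`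
(tree `freitasP`, `freitasN`), both series converge, `P > 0`, `N < 0` and `F(x,τ) = P(x,τ) + N(x,τ)`.

Proof AS PRINTED (p0010:L143–190), every input being a tree theorem:

* `F(x,τ) = Σ_{k≥0} (ℓ_k/(k+1)!) x(x+1)⋯(x+k) τᵏ` for `|τ| < |ρ|` (`∀ρ`) — Theorem 5.1,
  `Freitas2006_thm_5_1_holds` (dbl-t12); `0 < τ < 2 < 14 < |ρ|` (`FordL33.fourteen_lt_norm`).
* `ℓ₀ = log(2√π) − 1 − γ/2`, `ℓ_k = −1 + (1 − 2^{−k−1}) ζ(k+1) + (−1)ᵏ η_k` (`k ≥ 1`) — the displayed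
  expansion of `ℓ = ξ'/ξ` at `0`, `Freitas2006_ell_coeff_holds` (dbl-t12); so the `k`-th term of the
  `F`-series (`k ≥ 1`) is the sum of the `k`-th terms of `P` and of `N`, and the `0`-th is `ℓ₀ x`.
* "`(1 − 2^{−k−1}) ζ(k+1) − 1` is positive" — `three_pow_inv_lt_oddZeta_sub_one` (dbl-t13:
  `= Σ_{j≥1} (2j+1)^{−k−1} > 3^{−k−1}`); whence every term of `P` is `> 0`.
* "the coefficients `η_k` are positive for odd `k` and negative for even `k` … [coff2]" — Coffey's
  strict sign alternation `(−1)^{k+1} η_k > 0` for ALL `k`, [Coffey2008] Prop. 4.2 =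
  `Coffey2008_prop42_holds` (dbl-t13, `KeiperLiAsymptoticCriteriaProofs.lean`); whence every term of
  the `N`-series is `< 0`, and `ℓ₀ < 0` (`freitasEllCoeff_zero_zero_neg`, dbl-t12) makes `N < 0`.
* Convergence (the source: "`P` converges for `|τ| < 2`", in fact for `|τ| < 3`): the bound
  `Σ_{j≥1}(2j+1)^{−k} ≤ 3^{−(k−2)} Σ_{j≥1}(2j+1)^{−2}` and the binomial series
  `Σ_n x(x+1)⋯(x+n−1)/n! sⁿ = (1−s)^{−x}` (`hasSum_inv_one_sub_rpow`, dbl-t12) at `s = τ/3` dominate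
  the `P`-series; the `N`-series is the (convergent) `F`-series minus the `P`-series.

## Contents

* `FreitasSignSplit.hasSum_oddTail`, `.oddTail_pos` (+ private `exists_oddTail_le`) — the odd zeta
  tail `(1 − 2^{−k}) ζ(k) − 1 = Σ_{j≥0} (2j+3)^{−k}`, positive and `≤ C·3^{−k}` (`k ≥ 2`).
* `FreitasSignSplit.summable_P_term`, `.P_term_pos` — the terms of `P`.
* `FreitasSignSplit.F_term_succ` — term `k+1` of the `F`-series = term `k` of `P` + term `k` of `N`.
* `Freitas2006_cor_5_3_holds`.

## References

* P. Freitas, J. London Math. Soc. (2) 73 (2006) 399–414 = arXiv:math/0507368, Cor. 5.3.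
  [Freitas2006LiHalfPlanes]
* M. W. Coffey, Proc. R. Soc. A 464 (2008) 711–731, Prop. 4.2 p.719 (the source's [coff2],
  "New results on the Li constants", preprint 2004). [Coffey2008]
-/

noncomputable section

open Complex Filter Set Metric Finset
open scoped Nat Topology

namespace Literature.NumberTheory.LFunctions

namespace FreitasSignSplit

/-! ## The odd zeta tail `(1 − 2^{−k}) ζ(k) − 1 = Σ_{j≥1} (2j+1)^{−k}` -/

/-- Real form of the tree's `Xiao2020.hasSum_inv_odd_pow`: `Σ_{j≥0} (2j+1)^{−k} = (1 − 2^{−k}) ζ(k)`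
for `k ≥ 2`. [cite: Coffey2008, eq. (4.18) p.719] -/
theorem hasSum_inv_odd_pow_re {k : ℕ} (hk : 2 ≤ k) :
    HasSum (fun j : ℕ ↦ (((1 : ℝ) + 2 * (j : ℝ)) ^ k)⁻¹)
      ((1 - ((2 : ℝ) ^ k)⁻¹) * (riemannZeta k).re) := by
  have h := Xiao2020.hasSum_inv_odd_pow hk
  have hre : HasSum (fun j : ℕ ↦ (((1 : ℝ) + 2 * (j : ℝ)) ^ k)⁻¹)
      (((1 - 1 / 2 ^ k) * riemannZeta (k : ℂ))).re := by
    have h2 := (Complex.hasSum_iff _ _).1 h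
    refine h2.1.congr_fun ?_
    intro j
    show _ = ((((1 : ℂ) + 2 * (j : ℂ)) ^ k)⁻¹).re
    rw [show (((1 : ℂ) + 2 * (j : ℂ)) ^ k)⁻¹ = (((((1 : ℝ) + 2 * (j : ℝ)) ^ k)⁻¹ : ℝ) : ℂ) by
      push_cast; ring, Complex.ofReal_re]
  have hval : (((1 - 1 / 2 ^ k) * riemannZeta (k : ℂ))).re =
      (1 - ((2 : ℝ) ^ k)⁻¹) * (riemannZeta k).re := by
    rw [show ((1 : ℂ) - 1 / 2 ^ k) = (((1 - ((2 : ℝ) ^ k)⁻¹ : ℝ)) : ℂ) by push_cast; ring,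
      Complex.re_ofReal_mul]
  rwa [hval] at hre

/-- The odd zeta tail as a series over the odd integers `≥ 3`: for `k ≥ 2`,
`(1 − 2^{−k}) ζ(k) − 1 = Σ_{j≥0} (2j+3)^{−k}`. [cite: Coffey2008, eqs. (4.17)–(4.18) p.719] -/
theorem hasSum_oddTail {k : ℕ} (hk : 2 ≤ k) :
    HasSum (fun j : ℕ ↦ (((3 : ℝ) + 2 * (j : ℝ)) ^ k)⁻¹)
      ((1 - ((2 : ℝ) ^ k)⁻¹) * (riemannZeta k).re - 1) := by
  have h0 := (hasSum_nat_add_iff' 1).2 (hasSum_inv_odd_pow_re hk)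
  simp only [Finset.range_one, Finset.sum_singleton, Nat.cast_zero, mul_zero, add_zero, one_pow,
    inv_one] at h0
  refine h0.congr_fun fun j ↦ ?_
  push_cast
  ring_nf

/-- "`(1 − 2^{−(k+1)}) ζ(k+1) − 1` is positive" (p0010:L185–187): for `k ≥ 2`,
`0 < (1 − 2^{−k}) ζ(k) − 1` (indeed `> 3^{−k}`, tree `three_pow_inv_lt_oddZeta_sub_one`).
[cite: Freitas2006LiHalfPlanes, proof of Corollary 5.3 (arXiv p0010:L185)] -/
theorem oddTail_pos {k : ℕ} (hk : 2 ≤ k) : 0 < (1 - ((2 : ℝ) ^ k)⁻¹) * (riemannZeta k).re - 1 :=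
  lt_trans (by positivity) (three_pow_inv_lt_oddZeta_sub_one hk)

/-- Geometric comparison of the odd zeta tails: for `k ≥ 2`,
`(1 − 2^{−k}) ζ(k) − 1 ≤ 3^{−(k−2)} · [(1 − 2^{−2}) ζ(2) − 1]` (termwise `(2j+3)^{−k} ≤
3^{−(k−2)} (2j+3)^{−2}`). [folklore] -/
private theorem oddTail_le {k : ℕ} (hk : 2 ≤ k) :
    (1 - ((2 : ℝ) ^ k)⁻¹) * (riemannZeta k).re - 1 ≤
      ((3 : ℝ) ^ (k - 2))⁻¹ * ((1 - ((2 : ℝ) ^ (2 : ℕ))⁻¹) * (riemannZeta (2 : ℕ)).re - 1) := by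
  have h2 := (hasSum_oddTail (le_refl 2)).mul_left (((3 : ℝ) ^ (k - 2))⁻¹)
  refine hasSum_le (fun j ↦ ?_) (hasSum_oddTail hk) h2
  obtain ⟨i, rfl⟩ : ∃ i, k = i + 2 := ⟨k - 2, by omega⟩
  simp only [Nat.add_sub_cancel]
  have hj : (0 : ℝ) ≤ j := Nat.cast_nonneg j
  have h3 : (3 : ℝ) ^ i ≤ ((3 : ℝ) + 2 * (j : ℝ)) ^ i :=
    pow_le_pow_left₀ (by norm_num) (by linarith) i
  have h3pos : (0 : ℝ) < (3 : ℝ) ^ i := by positivity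
  rw [pow_add, mul_inv]
  exact mul_le_mul_of_nonneg_right (inv_anti₀ h3pos h3) (by positivity)

/-- **A uniform bound for the odd zeta tails**: there is `C ≥ 0` with
`(1 − 2^{−k}) ζ(k) − 1 ≤ C · 3^{−k}` for every `k ≥ 2` (`C = 9[(3/4)ζ(2) − 1] = 9(π²/8 − 1)`). [folklore] -/
private theorem exists_oddTail_le :
    ∃ C : ℝ, 0 ≤ C ∧ ∀ k : ℕ, 2 ≤ k →
      (1 - ((2 : ℝ) ^ k)⁻¹) * (riemannZeta k).re - 1 ≤ C * ((3 : ℝ) ^ k)⁻¹ := by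
  refine ⟨9 * ((1 - ((2 : ℝ) ^ (2 : ℕ))⁻¹) * (riemannZeta (2 : ℕ)).re - 1), ?_, fun k hk ↦ ?_⟩
  · exact mul_nonneg (by norm_num) (oddTail_pos (le_refl 2)).le
  · refine (oddTail_le hk).trans (le_of_eq ?_)
    obtain ⟨i, rfl⟩ : ∃ i, k = i + 2 := ⟨k - 2, by omega⟩
    simp only [Nat.add_sub_cancel]
    rw [pow_add, mul_inv]
    norm_num
    ring

/-! ## The terms of `P`, `N` and of the `F`-series -/

/-- The coefficient of `P` in the tree's spelling equals the odd zeta tail at `k + 2`. [folklore] -/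
private theorem P_coeff_eq (k : ℕ) :
    (1 - (2 : ℝ)⁻¹ ^ (k + 2)) * (riemannZeta ((k : ℂ) + 2)).re - 1 =
      (1 - ((2 : ℝ) ^ (k + 2))⁻¹) * (riemannZeta ((k + 2 : ℕ) : ℂ)).re - 1 := by
  rw [inv_pow]
  push_cast
  ring

/-- Every term of `P(x,τ)` is positive for `x, τ > 0`. [cite: Freitas2006LiHalfPlanes, proof of Corollary 5.3 (arXiv p0010:L183–187)] -/
theorem P_term_pos {x τ : ℝ} (hx : 0 < x) (hτ : 0 < τ) (k : ℕ) :
    0 < (((k + 2)! : ℝ))⁻¹ * (∏ j ∈ Finset.range (k + 2), (x + j)) *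
      ((1 - (2 : ℝ)⁻¹ ^ (k + 2)) * (riemannZeta (k + 2)).re - 1) * τ ^ (k + 1) := by
  have hc : 0 < (1 - (2 : ℝ)⁻¹ ^ (k + 2)) * (riemannZeta ((k : ℂ) + 2)).re - 1 := by
    rw [P_coeff_eq]; exact oddTail_pos (by omega)
  have hprod : 0 < ∏ j ∈ Finset.range (k + 2), (x + (j : ℝ)) :=
    Finset.prod_pos fun j _ ↦ by positivity
  have hfact : (0 : ℝ) < (((k + 2)! : ℝ))⁻¹ := by positivity
  positivity

/-- **Convergence of `P(x,τ)`** for `x > 0`, `0 < τ < 3` (so in particular on the source's range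
`0 < τ < 2`): domination by the binomial series at `τ/3`. [cite: Freitas2006LiHalfPlanes, Corollary 5.3 (arXiv p0010:L122 "converges for |τ| smaller than 2")] -/
theorem summable_P_term {x τ : ℝ} (hx : 0 < x) (hτ : 0 < τ) (hτ3 : τ < 3) :
    Summable (fun k : ℕ ↦ (((k + 2)! : ℝ))⁻¹ * (∏ j ∈ Finset.range (k + 2), (x + j)) *
      ((1 - (2 : ℝ)⁻¹ ^ (k + 2)) * (riemannZeta (k + 2)).re - 1) * τ ^ (k + 1)) := by
  obtain ⟨C, hC0, hC⟩ := exists_oddTail_le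
  have hs0 : 0 ≤ τ / 3 := by positivity
  have hs1 : τ / 3 < 1 := by linarith
  -- the binomial series `g n = x(x+1)⋯(x+n−1)/n! (τ/3)ⁿ`, shifted by two
  have hg2 : Summable (fun k : ℕ ↦ (∏ j ∈ Finset.range (k + 2), (x + (j : ℝ))) / ((k + 2)! : ℝ) *
      (τ / 3) ^ (k + 2)) :=
    (summable_nat_add_iff 2).2 (hasSum_inv_one_sub_rpow hs0 hs1 x).summable
  refine Summable.of_nonneg_of_le (fun k ↦ (P_term_pos hx hτ k).le) (fun k ↦ ?_)
    (hg2.mul_left (C / τ))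
  have hprod : 0 < ∏ j ∈ Finset.range (k + 2), (x + (j : ℝ)) :=
    Finset.prod_pos fun j _ ↦ by positivity
  have hck : (1 - (2 : ℝ)⁻¹ ^ (k + 2)) * (riemannZeta ((k : ℂ) + 2)).re - 1 ≤
      C * ((3 : ℝ) ^ (k + 2))⁻¹ := by
    rw [P_coeff_eq]; exact hC (k + 2) (by omega)
  have hfact : (0 : ℝ) < ((k + 2)! : ℝ) := by positivity
  have key : ((3 : ℝ) ^ (k + 2))⁻¹ * τ ^ (k + 1) = τ⁻¹ * (τ / 3) ^ (k + 2) := by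
    rw [div_pow, pow_succ τ (k + 1)]
    field_simp
  calc (((k + 2)! : ℝ))⁻¹ * (∏ j ∈ Finset.range (k + 2), (x + (j : ℝ))) *
        ((1 - (2 : ℝ)⁻¹ ^ (k + 2)) * (riemannZeta ((k : ℂ) + 2)).re - 1) * τ ^ (k + 1)
      = (((k + 2)! : ℝ))⁻¹ * (∏ j ∈ Finset.range (k + 2), (x + (j : ℝ))) * τ ^ (k + 1) *
          ((1 - (2 : ℝ)⁻¹ ^ (k + 2)) * (riemannZeta ((k : ℂ) + 2)).re - 1) := by ring
    _ ≤ (((k + 2)! : ℝ))⁻¹ * (∏ j ∈ Finset.range (k + 2), (x + (j : ℝ))) * τ ^ (k + 1) *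
          (C * ((3 : ℝ) ^ (k + 2))⁻¹) :=
        mul_le_mul_of_nonneg_left hck (by positivity)
    _ = C * ((((k + 2)! : ℝ))⁻¹ * (∏ j ∈ Finset.range (k + 2), (x + (j : ℝ)))) *
          (((3 : ℝ) ^ (k + 2))⁻¹ * τ ^ (k + 1)) := by ring
    _ = C * ((((k + 2)! : ℝ))⁻¹ * (∏ j ∈ Finset.range (k + 2), (x + (j : ℝ)))) *
          (τ⁻¹ * (τ / 3) ^ (k + 2)) := by rw [key]
    _ = C / τ * ((∏ j ∈ Finset.range (k + 2), (x + (j : ℝ))) / ((k + 2)! : ℝ) *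
          (τ / 3) ^ (k + 2)) := by ring

/-- The displayed expansion of `ℓ` at `0`, shifted: for every `k`,
`ℓ_{k+1} = [(1 − 2^{−(k+2)}) ζ(k+2) − 1] + (−1)^{k+1} η_{k+1}`.
[cite: Freitas2006LiHalfPlanes, proof of Corollary 5.3 (arXiv p0010:L175)] -/
theorem ell_succ (k : ℕ) :
    freitasEllCoeff 0 (k + 1) =
      ((1 - (2 : ℝ)⁻¹ ^ (k + 2)) * (riemannZeta ((k : ℂ) + 2)).re - 1) +
        (-1) ^ (k + 1) * liEta (k + 1) := by
  rw [Freitas2006_ell_coeff_holds.2 (k + 1) (by omega)]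
  have h : ((k + 1 : ℕ) : ℂ) + 1 = (k : ℂ) + 2 := by push_cast; ring
  rw [h]
  ring

/-- Term `k+1` of the `F`-series of Theorem 5.1 is the sum of the `k`-th terms of `P` and of the
`N`-series. [cite: Freitas2006LiHalfPlanes, proof of Corollary 5.3 (arXiv p0010:L181–183)] -/
theorem F_term_succ (x τ : ℝ) (k : ℕ) :
    freitasEllCoeff 0 (k + 1) / ((k + 1 + 1)! : ℝ) *
        (∏ j ∈ Finset.range (k + 1 + 1), (x + j)) * τ ^ (k + 1) =
      (((k + 2)! : ℝ))⁻¹ * (∏ j ∈ Finset.range (k + 2), (x + j)) *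
          ((1 - (2 : ℝ)⁻¹ ^ (k + 2)) * (riemannZeta (k + 2)).re - 1) * τ ^ (k + 1) +
        (-1) ^ (k + 1) / (((k + 2)! : ℝ)) * (∏ j ∈ Finset.range (k + 2), (x + j)) *
          liEta (k + 1) * τ ^ (k + 1) := by
  rw [ell_succ, show k + 1 + 1 = k + 2 from rfl]
  ring

/-- Every term of the `N`-series is negative for `x, τ > 0`: `(−1)^{k+1} η_{k+1} < 0` by Coffey's
strict sign alternation ([Coffey2008] Prop. 4.2, tree `Coffey2008_prop42_holds`).
[cite: Freitas2006LiHalfPlanes, proof of Corollary 5.3 (arXiv p0010:L186–188); Coffey2008, Prop. 4.2 p.719] -/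
theorem N_term_neg {x τ : ℝ} (hx : 0 < x) (hτ : 0 < τ) (k : ℕ) :
    (-1) ^ (k + 1) / (((k + 2)! : ℝ)) * (∏ j ∈ Finset.range (k + 2), (x + j)) *
      liEta (k + 1) * τ ^ (k + 1) < 0 := by
  have hη : (-1 : ℝ) ^ (k + 1) * liEta (k + 1) < 0 := by
    have h := Coffey2008_prop42_holds (k + 1)
    rw [pow_succ] at h
    nlinarith
  have hprod : 0 < ∏ j ∈ Finset.range (k + 2), (x + (j : ℝ)) :=
    Finset.prod_pos fun j _ ↦ by positivity
  have hfact : (0 : ℝ) < ((k + 2)! : ℝ) := by positivity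
  have hτk : 0 < τ ^ (k + 1) := by positivity
  have : (-1) ^ (k + 1) / (((k + 2)! : ℝ)) * (∏ j ∈ Finset.range (k + 2), (x + (j : ℝ))) *
      liEta (k + 1) * τ ^ (k + 1) =
      ((-1 : ℝ) ^ (k + 1) * liEta (k + 1)) *
        ((∏ j ∈ Finset.range (k + 2), (x + (j : ℝ))) / ((k + 2)! : ℝ) * τ ^ (k + 1)) := by
    ring
  rw [this]
  exact mul_neg_of_neg_of_pos hη (by positivity)

end FreitasSignSplit

open FreitasSignSplit in
/-- **Freitas 2006, Corollary 5.3** — DISCHARGED (RH-FREE): for `x > 0` and `0 < τ < 2`, the series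
`P(x,τ)` and `N(x,τ)` converge, `P(x,τ) > 0`, `N(x,τ) < 0` and `F(x,τ) = P(x,τ) + N(x,τ)`.  Proof as
printed: Theorem 5.1 (`Freitas2006_thm_5_1_holds`) and the expansion of `ℓ` at `0`
(`Freitas2006_ell_coeff_holds`) give the identity termwise; `(1 − 2^{−k−1}) ζ(k+1) − 1 > 0`
(`three_pow_inv_lt_oddZeta_sub_one`) and Coffey's sign alternation of `η_k` for all `k`
(`Coffey2008_prop42_holds`, the source's [coff2]) with `ℓ₀ < 0` (`freitasEllCoeff_zero_zero_neg`) give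
the signs. [cite: Freitas2006LiHalfPlanes, Corollary 5.3] -/
theorem Freitas2006_cor_5_3_holds : Freitas2006_cor_5_3 := by
  intro x τ hx hτ hτ2
  -- the two term sequences
  set a : ℕ → ℝ := fun k ↦ (((k + 2)! : ℝ))⁻¹ * (∏ j ∈ Finset.range (k + 2), (x + j)) *
    ((1 - (2 : ℝ)⁻¹ ^ (k + 2)) * (riemannZeta (k + 2)).re - 1) * τ ^ (k + 1) with ha
  set b : ℕ → ℝ := fun k ↦ (-1) ^ (k + 1) / (((k + 2)! : ℝ)) *
    (∏ j ∈ Finset.range (k + 2), (x + j)) * liEta (k + 1) * τ ^ (k + 1) with hb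
  -- the `F`-series of Theorem 5.1
  set f : ℕ → ℝ := fun k ↦ freitasEllCoeff 0 k / ((k + 1)! : ℝ) *
    (∏ j ∈ Finset.range (k + 1), (x + j)) * τ ^ k with hf
  have hzeros : ∀ ρ ∈ ZetaZeros.riemannZetaNontrivialZeros, |τ| < ‖ρ‖ := by
    intro ρ hρ
    have h14 : 14 < ‖ρ‖ := FordL33.fourteen_lt_norm ⟨ρ, hρ⟩
    rw [abs_of_pos hτ]
    linarith
  have hF : HasSum f (freitasF x τ) := Freitas2006_thm_5_1_holds x τ hzeros
  have hPs : Summable a := summable_P_term hx hτ (by linarith)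
  have hfab : ∀ k, f (k + 1) = a k + b k := fun k ↦ F_term_succ x τ k
  have hf1 : Summable (fun k ↦ f (k + 1)) := (summable_nat_add_iff 1).2 hF.summable
  have hNs : Summable b := by
    refine (hf1.sub hPs).congr fun k ↦ ?_
    show f (k + 1) - a k = b k
    rw [hfab]; ring
  have hapos : ∀ k, 0 < a k := fun k ↦ P_term_pos hx hτ k
  have hbneg : ∀ k, b k < 0 := fun k ↦ N_term_neg hx hτ k
  have hP : 0 < ∑' k, a k := hPs.tsum_pos (fun k ↦ (hapos k).le) 0 (hapos 0)
  have hN : ∑' k, b k < 0 := by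
    have h := hNs.neg.tsum_pos (fun k ↦ (neg_pos.2 (hbneg k)).le) 0 (neg_pos.2 (hbneg 0))
    rw [tsum_neg] at h
    linarith
  have hf0 : f 0 = freitasEllCoeff 0 0 * x := by
    simp [hf]
  have hsplit : freitasF x τ = freitasEllCoeff 0 0 * x + (∑' k, a k + ∑' k, b k) := by
    rw [← hF.tsum_eq, hF.summable.tsum_eq_zero_add, hf0, ← hPs.tsum_add hNs]
    congr 1
    exact tsum_congr hfab
  refine ⟨hPs, hNs, ?_, ?_, ?_⟩
  · -- `P > 0`
    show 0 < ∑' k, a k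
    exact hP
  · -- `N < 0`
    show (Real.log (2 * Real.sqrt Real.pi) - 1 - Real.eulerMascheroniConstant / 2) * x +
      ∑' k, b k < 0
    rw [← Freitas2006_ell_coeff_holds.1]
    have hℓ := mul_neg_of_neg_of_pos freitasEllCoeff_zero_zero_neg hx
    linarith
  · -- `F = P + N`
    show freitasF x τ = ∑' k, a k +
      ((Real.log (2 * Real.sqrt Real.pi) - 1 - Real.eulerMascheroniConstant / 2) * x + ∑' k, b k)
    rw [← Freitas2006_ell_coeff_holds.1, hsplit]
    ring

end Literature.NumberTheory.LFunctions
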